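import Summits.CriticalPhenomena.Ising3DConformalLimit.Theorems.FKParityRobustnessDefs
import Literature.Probability.LatticeModels.WeightedCurrentsIdentities
import HarnessLib

/-!
# The odd part of a sourced random current: loop-O(1) law and the parity lower bound
# (helpers for item `ParityBound`, stmt-CriticalPhenomena-8466, route `FKParityRobustness`)

For a finite graph `G = (V, E)`, `β ≥ 0`, currents `n : E → ℕ` (`Current G`, weights
`w_β(n) = ∏ β^{n_e}/n_e!` in the `ℝ≥0∞` spelling `Current.eweight`, sums `Z[S] = ecurrentSum`) and
four marked vertices `a : Fin 4 → V`, write `odd(n) = {e ∈ E : n_e odd}` (inlined as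
`(univ.filter fun e : G.edgeFinset => Odd (n e)).map (Function.Embedding.subtype _)`; no new
definition) and `D = {a₀} ∆ {a₁} ∆ {a₂} ∆ {a₃}`.  We prove:

* `tsum_sources_eweight_mul_apply_oddPart` — the ODD PART OF A SOURCED CURRENT IS SOURCED
  LOOP-O(1): `∑_{∂n = D} w_β(n) g(odd n) = ∑_{F ⊆ E, ∂F = D} sinh(β)^{|F|} cosh(β)^{|E|−|F|} g(F)`
  (`∂n = ∂ odd(n)`; per edge `∑_{k odd} βᵏ/k! = sinh β`, `∑_{k even} βᵏ/k! = cosh β`; product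
  formula `tsum_pi_nat_prod` of `ModifiedSimonInequality.lean`) — Duminil-Copin 2016, Remark 3.4;
  Hansen–Jiang–Klausen 2025, §2 (trace/odd part of the sourced current vs. `ℓ^A_{tanh β}`);
* `currentSum_four_add_oddPart_le` — the PARITY LOWER BOUND behind `U₄ ≤ −2 E_FK[u_A]`:
  `Z[D]Z[∅] + 2 Q Z[∅] ≤ Z[a₀a₁]Z[a₂a₃] + Z[a₀a₂]Z[a₁a₃] + Z[a₀a₃]Z[a₁a₂]`,
  `Q = ∑_{∂n = D} w_β(n) 1[odd(n) joins all aᵢ]`, from the tree's random-current identity for `U₄`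
  (`Current.ursellFour_currentSum_identity`: right side `= Z[D]Z[∅] + 2P`), the switching lemma
  (`Current.tsum_epairWeight_switch_pair`: `P = ∑ 1{∂n₁ = D}1{∂n₂ = ∅} w w 1[a₀↔a₂]1[a₂↔a₃]`) and
  `odd(n₁) ⊆ trace(n₁ + n₂)` (`P ≥ Q Z[∅]`);
* `tsum_sources_eweight_joinsAll_eq`, `ecurrentSum_empty_eq_ofReal` — the two evaluations
  `Q = cosh(β)^{|E|} Z_{tanh β}(A; C)` (`zMass … JoinsAll` of `FKParityRobustnessDefs`) and
  `Z[∅] = cosh(β)^{|E|} ∑_{F even} tanh(β)^{|F|}`.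

Theorem-only file.  References: M. Aizenman, Comm. Math. Phys. 86 (1982), Prop. 5.1
[AizenmanCMP1982]; H. Duminil-Copin, arXiv:1607.06933, Lemma 2.2, Remark 3.4, eq. (24)
[DuminilCopin2016]; U. T. Hansen, J. Jiang, F. R. Klausen, arXiv:2506.10765, §2
[HansenJiangKlausen2025].
-/

noncomputable section

open Finset
open scoped symmDiff ENNReal
open Literature.Probability.LatticeModels
open Summit.CriticalPhenomena.Ising3DConformalLimit.Cruxes.ParityRobustMerging.PlaquetteXorSurgery

namespace Summit.CriticalPhenomena.Ising3DConformalLimit.Theorems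

open scoped Classical

section OddPart

variable {V : Type*} [Fintype V] [DecidableEq V] {G : SimpleGraph V} [DecidableRel G.Adj]

/-! ### The odd part of a current

Throughout, the ODD PART of a current `n : E(G) → ℕ` is the edge set
`odd(n) = {e ∈ E(G) : n_e odd}`, written inline as
`(univ.filter fun e : G.edgeFinset => Odd (n e)).map (Function.Embedding.subtype _)`. -/

omit [DecidableEq V] in
/-- The odd part of a current is a set of edges of `G`. [folklore] -/
theorem oddPart_subset (n : Current G) :
    (univ.filter fun e : G.edgeFinset => Odd (n e)).map (Function.Embedding.subtype _) ⊆
      G.edgeFinset := by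
  intro x hx
  obtain ⟨e, -, rfl⟩ := Finset.mem_map.1 hx
  exact e.2

omit [DecidableEq V] in
/-- Membership in the odd part. [folklore] -/
theorem mem_oddPart_iff (n : Current G) (e : G.edgeFinset) :
    (e : Sym2 V) ∈ (univ.filter fun e : G.edgeFinset => Odd (n e)).map (Function.Embedding.subtype _) ↔
      Odd (n e) := by
  simp only [Finset.mem_map, Finset.mem_filter, Finset.mem_univ, true_and,
    Function.Embedding.coe_subtype]
  constructor
  · rintro ⟨e', he', h⟩
    rwa [← Subtype.ext h]
  · intro h
    exact ⟨e, h, rfl⟩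

omit [DecidableEq V] in
/-- For `F ⊆ E(G)`: `odd(n) = F` iff `n_e` is odd exactly on `F`. [folklore] -/
theorem forall_odd_iff_mem_iff (n : Current G) {F : Finset (Sym2 V)} (hF : F ⊆ G.edgeFinset) :
    (∀ e : G.edgeFinset, Odd (n e) ↔ (e : Sym2 V) ∈ F) ↔
      F = (univ.filter fun e : G.edgeFinset => Odd (n e)).map (Function.Embedding.subtype _) := by
  constructor
  · intro h
    ext x
    constructor
    · intro hx
      exact (mem_oddPart_iff n ⟨x, hF hx⟩).2 ((h ⟨x, hF hx⟩).2 hx)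
    · intro hx
      obtain ⟨e, he, rfl⟩ := Finset.mem_map.1 hx
      exact (h e).1 (Finset.mem_filter.1 he).2
  · rintro rfl e
    exact (mem_oddPart_iff n e).symm

/-- The sources of a current are the odd-degree vertices of its odd part: `∂n = ∂ odd(n)`. [folklore] -/
theorem mem_sources_iff_odd_card_oddPart (n : Current G) (v : V) :
    v ∈ n.sources ↔
      Odd #(((univ.filter fun e : G.edgeFinset => Odd (n e)).map
        (Function.Embedding.subtype _)).filter (v ∈ ·)) := by
  rw [Current.mem_sources_iff, Current.degree, ← Nat.not_even_iff_odd,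
    Literature.Probability.LatticeModels.even_sum_iff_even_card_odd, Nat.not_even_iff_odd,
    Finset.filter_map, Finset.card_map, Finset.filter_filter]
  have h : (univ.filter fun e : G.edgeFinset => Odd (if v ∈ (e : Sym2 V) then n e else 0)) =
      univ.filter fun e : G.edgeFinset => Odd (n e) ∧ ((v ∈ ·) ∘ (Function.Embedding.subtype
        (· ∈ G.edgeFinset))) e := by
    ext e
    simp only [Finset.mem_filter, Finset.mem_univ, true_and, Function.comp_apply,
      Function.Embedding.coe_subtype]
    by_cases hv : v ∈ (e : Sym2 V)
    · simp [hv]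
    · simp [hv]
  rw [h]

/-- `∂n = D` iff the odd part of `n` is a `T`-join of `D` (the source condition of `tJoins`). [folklore] -/
theorem sources_eq_iff_oddPart (n : Current G) (D : Finset V) :
    n.sources = D ↔ ∀ v, Odd #(((univ.filter fun e : G.edgeFinset => Odd (n e)).map
        (Function.Embedding.subtype _)).filter (v ∈ ·)) ↔ v ∈ D := by
  rw [Finset.ext_iff]
  refine forall_congr' fun v => ?_
  rw [mem_sources_iff_odd_card_oddPart]

omit [DecidableEq V] in
/-- The `ℝ≥0∞` weight of a current at uniform coupling `β ≥ 0` is the product of the edge weights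
`β^{n_e}/n_e!`. [folklore] -/
theorem eweight_const_eq_prod {β : ℝ} (hβ : 0 ≤ β) (n : Current G) :
    n.eweight (fun _ => β) = ∏ e, edgeWeight β (n e) := by
  unfold Current.eweight Current.wweight edgeWeight
  exact ENNReal.ofReal_prod_of_nonneg fun e _ => by positivity

/-- The image of `{e : E | ↑e ∈ F}` under the subtype embedding is `F`, for `F ⊆ E`. [folklore] -/
theorem map_subtype_univ_filter_mem {α : Type*} [DecidableEq α] {s F : Finset α} (hF : F ⊆ s) :
    (univ.filter fun e : s => (e : α) ∈ F).map (Function.Embedding.subtype _) = F := by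
  ext x
  simp only [Finset.mem_map, Finset.mem_filter, Finset.mem_univ, true_and,
    Function.Embedding.coe_subtype]
  constructor
  · rintro ⟨e, he, rfl⟩
    exact he
  · intro hx
    exact ⟨⟨x, hF hx⟩, hx, rfl⟩

/-- **Summing the currents with prescribed odd part** (Duminil-Copin 2016, Remark 3.4: a current is
a high-temperature graph dressed with even multiplicities): for `β ≥ 0` and `F ⊆ E(G)`,
`∑_{n : odd(n) = F} w_β(n) = sinh(β)^{|F|} cosh(β)^{|E| − |F|}` (`∑_{k odd} βᵏ/k! = sinh β`,
`∑_{k even} βᵏ/k! = cosh β`, product formula over the edges). [cite: DuminilCopin2016, Remark 3.4] -/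
theorem tsum_eweight_oddPart_eq {β : ℝ} (hβ : 0 ≤ β) {F : Finset (Sym2 V)}
    (hF : F ⊆ G.edgeFinset) :
    ∑' n : Current G,
        (if (∀ e : G.edgeFinset, Odd (n e) ↔ (e : Sym2 V) ∈ F) then n.eweight (fun _ => β) else 0) =
      ENNReal.ofReal (Real.sinh β ^ #F * Real.cosh β ^ (#G.edgeFinset - #F)) := by
  have h1 : ∀ n : Current G,
      (if (∀ e : G.edgeFinset, Odd (n e) ↔ (e : Sym2 V) ∈ F) then n.eweight (fun _ => β) else 0) =
        ∏ e : G.edgeFinset, (if (Odd (n e) ↔ (e : Sym2 V) ∈ F) then edgeWeight β (n e) else 0) := by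
    intro n
    rw [Finset.prod_ite_zero, eweight_const_eq_prod hβ]
    simp only [Finset.mem_univ, forall_const]
  simp_rw [h1]
  rw [tsum_pi_nat_prod (fun (e : G.edgeFinset) k => if (Odd k ↔ (e : Sym2 V) ∈ F) then edgeWeight β k else 0)]
  have h2 : ∀ e : G.edgeFinset,
      (∑' k, if (Odd k ↔ (e : Sym2 V) ∈ F) then edgeWeight β k else 0) =
        if (e : Sym2 V) ∈ F then ENNReal.ofReal (Real.sinh β) else ENNReal.ofReal (Real.cosh β) := by
    intro e
    by_cases he : (e : Sym2 V) ∈ F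
    · rw [if_pos he, ← tsum_edgeWeight_odd hβ]
      refine tsum_congr fun k => ?_
      simp only [he, iff_true]
    · rw [if_neg he, ← tsum_edgeWeight_even hβ]
      refine tsum_congr fun k => ?_
      simp only [he, iff_false, Nat.not_odd_iff_even]
  rw [Finset.prod_congr rfl fun e _ => h2 e, Finset.prod_ite, Finset.prod_const, Finset.prod_const]
  have hc1 : #(univ.filter fun e : G.edgeFinset => (e : Sym2 V) ∈ F) = #F := by
    conv_rhs => rw [← map_subtype_univ_filter_mem hF]
    rw [Finset.card_map]
  have hc2 : #(univ.filter fun e : G.edgeFinset => ¬ (e : Sym2 V) ∈ F) = #G.edgeFinset - #F := by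
    have h := Finset.card_filter_add_card_filter_not
      (s := (univ : Finset G.edgeFinset)) (fun e : G.edgeFinset => (e : Sym2 V) ∈ F)
    rw [hc1, Finset.card_univ, Fintype.card_coe] at h
    omega
  rw [hc1, hc2, ENNReal.ofReal_mul (pow_nonneg (Real.sinh_nonneg_iff.2 hβ) _),
    ENNReal.ofReal_pow (Real.sinh_nonneg_iff.2 hβ), ENNReal.ofReal_pow (Real.cosh_pos β).le]

/-- **The odd part of a sourced random current is sourced-loop-O(1) distributed** (the
`sinh`/`cosh` expansion; Duminil-Copin 2016, Remark 3.4; Hansen–Jiang–Klausen 2025, §2): for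
`β ≥ 0`, a source set `D` and any `g ≥ 0` on edge sets,
`∑_{∂n = D} w_β(n) g(odd(n)) = ∑_{F ⊆ E, ∂F = D} sinh(β)^{|F|} cosh(β)^{|E|−|F|} g(F)`.
[cite: DuminilCopin2016, Remark 3.4] -/
theorem tsum_sources_eweight_mul_apply_oddPart {β : ℝ} (hβ : 0 ≤ β) (D : Finset V)
    (g : Finset (Sym2 V) → ℝ≥0∞) :
    ∑' n : Current G, (if n.sources = D then n.eweight (fun _ => β) else 0) *
        g ((univ.filter fun e : G.edgeFinset => Odd (n e)).map (Function.Embedding.subtype _)) =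
      ∑ F ∈ G.edgeFinset.powerset, if (∀ v, Odd #(F.filter (v ∈ ·)) ↔ v ∈ D) then
        ENNReal.ofReal (Real.sinh β ^ #F * Real.cosh β ^ (#G.edgeFinset - #F)) * g F else 0 := by
  have hΦ : ∀ n : Current G, (if n.sources = D then n.eweight (fun _ => β) else 0) *
      g ((univ.filter fun e : G.edgeFinset => Odd (n e)).map (Function.Embedding.subtype _)) =
      ∑ F ∈ G.edgeFinset.powerset,
        (if (∀ e : G.edgeFinset, Odd (n e) ↔ (e : Sym2 V) ∈ F) then n.eweight (fun _ => β) else 0) *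
          (if (∀ v, Odd #(F.filter (v ∈ ·)) ↔ v ∈ D) then g F else 0) := by
    intro n
    symm
    calc ∑ F ∈ G.edgeFinset.powerset,
          (if (∀ e : G.edgeFinset, Odd (n e) ↔ (e : Sym2 V) ∈ F) then n.eweight (fun _ => β) else 0) *
            (if (∀ v, Odd #(F.filter (v ∈ ·)) ↔ v ∈ D) then g F else 0)
        = ∑ F ∈ G.edgeFinset.powerset,
            (if F = (univ.filter fun e : G.edgeFinset => Odd (n e)).map (Function.Embedding.subtype _)
              then n.eweight (fun _ => β) * (if (∀ v, Odd #(F.filter (v ∈ ·)) ↔ v ∈ D) then g F else 0)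
              else 0) := by
          refine Finset.sum_congr rfl fun F hF => ?_
          rw [ite_mul, zero_mul]
          exact if_congr (forall_odd_iff_mem_iff n (Finset.mem_powerset.1 hF)) rfl rfl
      _ = n.eweight (fun _ => β) *
            (if (∀ v, Odd #(((univ.filter fun e : G.edgeFinset => Odd (n e)).map
              (Function.Embedding.subtype _)).filter (v ∈ ·)) ↔ v ∈ D) then
              g ((univ.filter fun e : G.edgeFinset => Odd (n e)).map (Function.Embedding.subtype _))
              else 0) := by
          rw [Finset.sum_ite_eq', if_pos (Finset.mem_powerset.2 (oddPart_subset n))]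
      _ = _ := by
          by_cases h : n.sources = D
          · rw [if_pos h, if_pos ((sources_eq_iff_oddPart n D).1 h)]
          · rw [if_neg h, if_neg (fun h' => h ((sources_eq_iff_oddPart n D).2 h')), zero_mul,
              mul_zero]
  simp_rw [hΦ]
  rw [Summable.tsum_finsetSum (fun F _ => ENNReal.summable)]
  refine Finset.sum_congr rfl fun F hF => ?_
  rw [ENNReal.tsum_mul_right, tsum_eweight_oddPart_eq hβ (Finset.mem_powerset.1 hF), mul_ite,
    mul_zero]

end OddPart

section Currents

variable {V : Type*} [Fintype V] [DecidableEq V] {G : SimpleGraph V} [DecidableRel G.Adj]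

/-! ### From the double random current to the odd part of the sourced current -/

omit [DecidableEq V] in
/-- The odd part of `n₁` lies in the trace of `n₁ + n₂`. [folklore] -/
theorem coe_oddPart_subset_traced_add (n₁ n₂ : Current G) :
    (↑((univ.filter fun e : G.edgeFinset => Odd (n₁ e)).map (Function.Embedding.subtype _)) :
        Set (Sym2 V)) ⊆ (n₁ + n₂).traced := by
  intro x hx
  obtain ⟨e, he, rfl⟩ := Finset.mem_map.1 (Finset.mem_coe.1 hx)
  rw [Function.Embedding.coe_subtype, Current.mem_traced_iff, Pi.add_apply]
  have hodd : Odd (n₁ e) := (Finset.mem_filter.1 he).2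
  have h := hodd.pos
  omega

/-- If the odd part of `n₁` joins all four marked vertices, then in the trace of `n₁ + n₂` the
vertex `a 2` lies in the cluster of `a 0` and `a 3` in the cluster of `a 2`
(`odd(n₁) ⊆ trace(n₁ + n₂)`). [folklore] -/
theorem ite_joinsAll_oddPart_le (a : Fin 4 → V) (p : Current G × Current G) :
    (if JoinsAll a ((univ.filter fun e : G.edgeFinset => Odd (p.1 e)).map
        (Function.Embedding.subtype _)) then (1 : ℝ≥0∞) else 0) ≤
      (if a 2 ∈ (p.1 + p.2).cluster (a 0) then (1 : ℝ≥0∞) else 0) *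
        (if a 3 ∈ (p.1 + p.2).cluster (a 2) then 1 else 0) := by
  by_cases h : JoinsAll a ((univ.filter fun e : G.edgeFinset => Odd (p.1 e)).map
      (Function.Embedding.subtype _))
  · have hle : SimpleGraph.fromEdgeSet (↑((univ.filter fun e : G.edgeFinset => Odd (p.1 e)).map
        (Function.Embedding.subtype _)) : Set (Sym2 V)) ≤
        Literature.Probability.Percolation.openGraph (p.1 + p.2).traced :=
      SimpleGraph.fromEdgeSet_mono (coe_oddPart_subset_traced_add p.1 p.2)
    have h02 : a 2 ∈ (p.1 + p.2).cluster (a 0) := Current.mem_cluster_iff.2 ((h 0 2).mono hle)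
    have h23 : a 3 ∈ (p.1 + p.2).cluster (a 2) := Current.mem_cluster_iff.2 ((h 2 3).mono hle)
    rw [if_pos h, if_pos h02, if_pos h23, mul_one]
  · rw [if_neg h]
    exact bot_le

/-- **The current-side inequality** (`ℝ≥0∞` form).  With `Z[S]` the current sums at uniform
coupling `β ≥ 0`, `D = {a₀} ∆ {a₁} ∆ {a₂} ∆ {a₃}` and
`Q = ∑_{∂n = D} w_β(n) 1[odd(n) joins all aᵢ]`,
`Z[D] Z[∅] + 2 Q Z[∅] ≤ Z[a₀a₁]Z[a₂a₃] + Z[a₀a₂]Z[a₁a₃] + Z[a₀a₃]Z[a₁a₂]`.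
From the random-current identity for `U₄` (`Current.ursellFour_currentSum_identity`: the right side
is `Z[D]Z[∅] + 2P`, `P = ∑ 1{∂n₁ = a₀a₁} 1{∂n₂ = a₂a₃} w w 1[a₂ ∈ C_{n₁+n₂}(a₀)]`), the switching
lemma (`P = ∑ 1{∂n₁ = D} 1{∂n₂ = ∅} w w 1[a₂ ∈ C(a₀)] 1[a₃ ∈ C(a₂)]`) and
`odd(n₁) ⊆ trace(n₁ + n₂)` (`P ≥ Q · Z[∅]`).
[cite: AizenmanCMP1982, Prop. 5.1] -/
theorem currentSum_four_add_oddPart_le {β : ℝ} (hβ : 0 ≤ β) (a : Fin 4 → V) :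
    ecurrentSum (fun _ : G.edgeFinset => β) ({a 0} ∆ ({a 1} ∆ ({a 2} ∆ {a 3}))) * ecurrentSum (fun _ : G.edgeFinset => β) ∅ +
      2 * ((∑' n : Current G,
          (if n.sources = {a 0} ∆ ({a 1} ∆ ({a 2} ∆ {a 3})) then n.eweight (fun _ : G.edgeFinset => β) else 0) *
            (if JoinsAll a ((univ.filter fun e : G.edgeFinset => Odd (n e)).map
              (Function.Embedding.subtype _)) then 1 else 0)) * ecurrentSum (fun _ : G.edgeFinset => β) ∅) ≤
    ecurrentSum (fun _ : G.edgeFinset => β) ({a 0} ∆ {a 1}) * ecurrentSum (fun _ : G.edgeFinset => β) ({a 2} ∆ {a 3}) +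
      ecurrentSum (fun _ : G.edgeFinset => β) ({a 0} ∆ {a 2}) * ecurrentSum (fun _ : G.edgeFinset => β) ({a 1} ∆ {a 3}) +
      ecurrentSum (fun _ : G.edgeFinset => β) ({a 0} ∆ {a 3}) * ecurrentSum (fun _ : G.edgeFinset => β) ({a 1} ∆ {a 2}) := by
  have hK : ∀ _e : G.edgeFinset, 0 ≤ β := fun _ => hβ
  rw [Current.ursellFour_currentSum_identity (K := fun _ => β) hK (a 0) (a 1) (a 2) (a 3)]
  refine add_le_add le_rfl (mul_le_mul' le_rfl ?_)
  set D : Finset V := {a 0} ∆ ({a 1} ∆ ({a 2} ∆ {a 3})) with hD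
  have hzt : D ∆ ({a 2} ∆ {a 3}) = {a 0} ∆ {a 1} := by
    rw [hD]; ext v; simp only [Finset.mem_symmDiff, Finset.mem_singleton]; tauto
  have hP := Current.tsum_epairWeight_switch_pair (K := fun _ => β) hK D (a 2) (a 3)
    (fun m => if a 2 ∈ m.cluster (a 0) then 1 else 0)
  rw [hzt] at hP
  rw [hP]
  calc (∑' n : Current G, (if n.sources = D then n.eweight (fun _ : G.edgeFinset => β) else 0) *
          (if JoinsAll a ((univ.filter fun e : G.edgeFinset => Odd (n e)).map
            (Function.Embedding.subtype _)) then 1 else 0)) * ecurrentSum (fun _ : G.edgeFinset => β) ∅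
      = ∑' p : Current G × Current G,
          ((if p.1.sources = D then p.1.eweight (fun _ : G.edgeFinset => β) else 0) *
            (if JoinsAll a ((univ.filter fun e : G.edgeFinset => Odd (p.1 e)).map
              (Function.Embedding.subtype _)) then 1 else 0)) *
          (if p.2.sources = ∅ then p.2.eweight (fun _ : G.edgeFinset => β) else 0) := by
        unfold ecurrentSum
        exact tsum_mul_tsum_eq_tsum_prod _ _
    _ = ∑' p : Current G × Current G, epairWeight (fun _ : G.edgeFinset => β) D ∅ p *
          (if JoinsAll a ((univ.filter fun e : G.edgeFinset => Odd (p.1 e)).map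
              (Function.Embedding.subtype _)) then 1 else 0) :=
        tsum_congr fun p => by rw [epairWeight_eq_mul]; ring
    _ ≤ _ := ENNReal.tsum_le_tsum fun p => mul_le_mul' le_rfl (ite_joinsAll_oddPart_le a p)

/-! ### Evaluating the current sums by the loop O(1) (`tanh`) expansion -/

/-- `sinh(β)^k cosh(β)^{m−k} = cosh(β)^m tanh(β)^k` for `k ≤ m`. [folklore] -/
theorem sinh_pow_mul_cosh_pow_sub (β : ℝ) {k m : ℕ} (hk : k ≤ m) :
    Real.sinh β ^ k * Real.cosh β ^ (m - k) = Real.cosh β ^ m * Real.tanh β ^ k := by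
  have hc : Real.cosh β ≠ 0 := (Real.cosh_pos β).ne'
  rw [Real.tanh_eq_sinh_div_cosh, div_pow, pow_sub₀ _ hc hk]
  field_simp

/-- The sourced current sum restricted to currents whose odd part joins all four marked vertices,
as a loop-O(1) mass: `∑_{∂n = {aᵢ}} w_β(n) 1[odd(n) ∈ C] = cosh(β)^{|E|} · Z_{tanh β}(A; C)`
(`zMass`). [cite: DuminilCopin2016, Remark 3.4] -/
theorem tsum_sources_eweight_joinsAll_eq {β : ℝ} (hβ : 0 ≤ β) (a : Fin 4 → V) :
    ∑' n : Current G, (if n.sources = univ.image a then n.eweight (fun _ : G.edgeFinset => β) else 0) *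
        (if JoinsAll a ((univ.filter fun e : G.edgeFinset => Odd (n e)).map
          (Function.Embedding.subtype _)) then 1 else 0) =
      ENNReal.ofReal (Real.cosh β ^ #G.edgeFinset *
        zMass G (Real.tanh β) a (fun F => JoinsAll a F)) := by
  have ht : 0 ≤ Real.tanh β := by
    rw [Real.tanh_eq_sinh_div_cosh]
    exact div_nonneg (Real.sinh_nonneg_iff.2 hβ) (Real.cosh_pos β).le
  rw [tsum_sources_eweight_mul_apply_oddPart hβ (univ.image a)
    (fun F => if JoinsAll a F then 1 else 0)]
  unfold zMass
  rw [Finset.mul_sum, ENNReal.ofReal_sum_of_nonneg (fun F _ => by positivity), tJoins,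
    Finset.sum_filter, Finset.sum_filter]
  refine Finset.sum_congr rfl fun F hF => ?_
  have hle : #F ≤ #G.edgeFinset := Finset.card_le_card (Finset.mem_powerset.1 hF)
  by_cases hc : (∀ v, Odd #(F.filter (v ∈ ·)) ↔ v ∈ univ.image a)
  · have hc' : (↑F : Set (Sym2 V)) ⊆ Set.univ ∧
        (∀ v, Odd #(F.filter (v ∈ ·)) ↔ v ∈ univ.image a) := ⟨Set.subset_univ _, hc⟩
    rw [if_pos hc, if_pos hc']
    by_cases hJ : JoinsAll a F
    · rw [if_pos hJ, if_pos hJ, mul_one, sinh_pow_mul_cosh_pow_sub β hle]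
    · rw [if_neg hJ, if_neg hJ, mul_zero]
  · have hc' : ¬ ((↑F : Set (Sym2 V)) ⊆ Set.univ ∧
        (∀ v, Odd #(F.filter (v ∈ ·)) ↔ v ∈ univ.image a)) := fun h => hc h.2
    rw [if_neg hc, if_neg hc']

/-- The sourceless current sum as a loop-O(1) partition function:
`Z_β[∅] = cosh(β)^{|E|} ∑_{F even} tanh(β)^{|F|}` (van der Waerden's high-temperature expansion
through currents; Duminil-Copin 2016, Remark 3.4). [cite: DuminilCopin2016, Remark 3.4] -/
theorem ecurrentSum_empty_eq_ofReal {β : ℝ} (hβ : 0 ≤ β) :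
    ecurrentSum (fun _ : G.edgeFinset => β) ∅ =
      ENNReal.ofReal (Real.cosh β ^ #G.edgeFinset *
        ∑ F ∈ evenSubgraphs G Set.univ, Real.tanh β ^ #F) := by
  have ht : 0 ≤ Real.tanh β := by
    rw [Real.tanh_eq_sinh_div_cosh]
    exact div_nonneg (Real.sinh_nonneg_iff.2 hβ) (Real.cosh_pos β).le
  have h := tsum_sources_eweight_mul_apply_oddPart (G := G) hβ ∅ (fun _ => 1)
  simp only [mul_one] at h
  unfold ecurrentSum
  rw [h, Finset.mul_sum, ENNReal.ofReal_sum_of_nonneg (fun F _ => by positivity), evenSubgraphs,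
    tJoins, Finset.sum_filter]
  refine Finset.sum_congr rfl fun F hF => ?_
  have hle : #F ≤ #G.edgeFinset := Finset.card_le_card (Finset.mem_powerset.1 hF)
  by_cases hc : (∀ v, Odd #(F.filter (v ∈ ·)) ↔ v ∈ (∅ : Finset V))
  · have hc' : (↑F : Set (Sym2 V)) ⊆ Set.univ ∧
        (∀ v, Odd #(F.filter (v ∈ ·)) ↔ v ∈ (∅ : Finset V)) := ⟨Set.subset_univ _, hc⟩
    rw [if_pos hc, if_pos hc', sinh_pow_mul_cosh_pow_sub β hle]
  · have hc' : ¬ ((↑F : Set (Sym2 V)) ⊆ Set.univ ∧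
        (∀ v, Odd #(F.filter (v ∈ ·)) ↔ v ∈ (∅ : Finset V))) := fun h => hc h.2
    rw [if_neg hc, if_neg hc']

end Currents

end Summit.CriticalPhenomena.Ising3DConformalLimit.Theorems

end
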